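import Literature.Computability.QuantumComplexity.PauliRotationLetterLawExactness
import HarnessLib

/-!
# A depth floor for exactly mixing rotation-word ensembles: `k ≥ 2n − 1`

Typed by qa-dq-idea-5 g9 (cell `qa-dq`); filed through the lead desk, which changed no statement and no proof.

OBJECT.  ANY finite family of length-`k` rotation words on `n` wires, `w : κ → (Fin k → (ι → Pauli))` — i.i.d.,
position-dependent or position-correlated letter laws alike (every law uniform on a finite index set `κ`) — with its
ensemble `g ↦ RotationWords.wordU k (w g)` and label walk `g ↦ RotationWords.walk k (w g)`.

LEVER (trace obstruction).  A label commuting with every letter of a word is FIXED by its walk; by character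
orthogonality at least `4ⁿ/2ᵏ` labels commute with any `k` given strings; so `Σ_{U ≠ I} #{g : walk (w g) U = U} ≥
|κ|·(4ⁿ/2ᵏ − 1)`, while exact mixing forces this trace to be `(4ⁿ − 1)·|κ|/(4ⁿ − 1) = |κ|`.  Hence an exactly
Clifford–Pauli mixing ensemble of length-`k` rotation words on `n` wires needs `4ⁿ ≤ 2^{k+1}`, i.e. `k ≥ 2n − 1`.

HONEST SCOPE.  Exactness only; angle `π/2`; nothing on approximate rates, designs, samplers or hardness.  Attainment of the
floor is NOT treated here (`n = 2`, `k = 3`: attained per an exact finite certificate in the cell's records, untyped;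
`n ≥ 3` open).  Nothing here proves or refutes quantum advantage.
-/
open Matrix Finset Complex

namespace Literature.Computability.QuantumComplexity

namespace PauliMixingPurity.RotationWords.DepthFloor

open PauliPath PauliPropagation LocalScrambling.TransientFloor PauliMixingPurity.Witness PauliMixingPurity.Approx
  PauliMixingPurity.RotationWords.LetterLaw

variable {ι : Type*} [Fintype ι] [DecidableEq ι]
variable {κ : Type*} [Fintype κ]

/-! ## 1. Character sums -/

omit [DecidableEq ι] in
/-- `s_I(U) = 1`. [cite: KempeEtAl2010, §2 Observation 4] -/
private theorem strSign_idStr_left' (U : ι → Pauli) : strSign idStr U = 1 := by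
  unfold strSign; exact Finset.prod_eq_one fun i _ => by cases U i <;> rfl

/-- `Σ_U s_a(U) s_b(U) = 4ⁿ [a = b]` (`PauliPath.sum_strSign_mul_strSign` BY NAME, symmetric orientation).
[cite: AharonovEtAl2023, §2 (proof of Lemma 2)] -/
private theorem sum_strSign_strSign (a b : ι → Pauli) :
    ∑ U : ι → Pauli, strSign a U * strSign b U = if a = b then (4 : ℂ) ^ Fintype.card ι else 0 := by
  rw [← sum_strSign_mul_strSign a b]
  exact Finset.sum_congr rfl fun U _ => by rw [OTOC.strSign_comm a U, OTOC.strSign_comm b U]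

/-- `Σ_U s_W(U) = 4ⁿ [W = I]`. [cite: AharonovEtAl2023, §2 (proof of Lemma 2)] -/
private theorem sum_strSign_right' (W : ι → Pauli) :
    ∑ U : ι → Pauli, strSign W U = if W = idStr then (4 : ℂ) ^ Fintype.card ι else 0 := by
  rw [← sum_strSign_strSign W idStr]
  exact Finset.sum_congr rfl fun U _ => by rw [strSign_idStr_left', mul_one]

/-- The commutant indicator product `F_w(U) = ∏_j (1 + s_{w j}(U))`. [cite: AharonovEtAl2023, §2 (proof of Lemma 2)] -/
def commProd (k : ℕ) (w : Fin k → ι → Pauli) (U : ι → Pauli) : ℂ := ∏ j : Fin k, (1 + strSign (w j) U)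

omit [DecidableEq ι] in
/-- `F_w(U) = 2ᵏ` if `U` commutes with every letter, `0` otherwise. [cite: KempeEtAl2010, §2 Observation 4] -/
theorem commProd_eq (k : ℕ) (w : Fin k → ι → Pauli) (U : ι → Pauli) :
    commProd k w U = if ∀ j, strSign (w j) U = 1 then (2 : ℂ) ^ k else 0 := by
  unfold commProd
  split_ifs with h
  · rw [Finset.prod_congr rfl fun j _ => by rw [h j], Finset.prod_const, Finset.card_univ, Fintype.card_fin]; norm_num
  · obtain ⟨j, hj⟩ := not_forall.mp h
    have hm : strSign (w j) U = -1 := (OTOC.strSign_eq_one_or (w j) U).resolve_left hj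
    exact Finset.prod_eq_zero (Finset.mem_univ j) (by rw [hm]; norm_num)

/-- **TWISTED COMMUTANT SUMS ARE NON-NEGATIVE MULTIPLES OF `4ⁿ`, AT LEAST `4ⁿ` UNTWISTED**:
`Σ_U F_w(U) s_W(U) = 4ⁿ·m` with `m ≥ 1` when `W = I` (induction on `k`: `(1 + s_{w_k}) s_W = s_W + s_{w_k W}`).
[cite: AharonovEtAl2023, §2 (proof of Lemma 2)] -/
theorem sum_commProd_mul_strSign : ∀ (k : ℕ) (w : Fin k → ι → Pauli) (W : ι → Pauli), ∃ m : ℕ,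
    ∑ U : ι → Pauli, commProd k w U * strSign W U = (4 : ℂ) ^ Fintype.card ι * m ∧ (W = idStr → 1 ≤ m) := by
  intro k
  induction k with
  | zero =>
    intro w W
    refine ⟨if W = idStr then 1 else 0, ?_, fun h => by rw [if_pos h]⟩
    have h0 : ∀ U : ι → Pauli, commProd 0 w U * strSign W U = strSign W U := fun U => by
      rw [commProd, Finset.univ_eq_empty, Finset.prod_empty, one_mul]
    rw [Finset.sum_congr rfl fun U _ => h0 U, sum_strSign_right']
    by_cases hW : W = idStr
    · rw [if_pos hW, if_pos hW, Nat.cast_one, mul_one]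
    · rw [if_neg hW, if_neg hW, Nat.cast_zero, mul_zero]
  | succ k ih =>
    intro w W
    obtain ⟨m₁, h₁, hm₁⟩ := ih (fun j => w j.castSucc) W
    obtain ⟨m₂, h₂, -⟩ := ih (fun j => w j.castSucc) (stringMul (w (Fin.last k)) W)
    refine ⟨m₁ + m₂, ?_, fun h => (hm₁ h).trans (Nat.le_add_right _ _)⟩
    have hsplit : ∀ U : ι → Pauli, commProd (k + 1) w U * strSign W U =
        commProd k (fun j => w j.castSucc) U * strSign W U +
          commProd k (fun j => w j.castSucc) U * strSign (stringMul (w (Fin.last k)) W) U := by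
      intro U
      rw [commProd, Fin.prod_univ_castSucc, strSign_stringMul_left, commProd]
      ring
    rw [Finset.sum_congr rfl fun U _ => hsplit U, Finset.sum_add_distrib, h₁, h₂]
    push_cast; ring

/-- **THE COMMON COMMUTANT OF `k` STRINGS HAS AT LEAST `4ⁿ/2ᵏ` ELEMENTS**. [cite: AharonovEtAl2023, §2 (proof of
Lemma 2)] [cite: KempeEtAl2010, §2 Observation 4] -/
theorem pow_le_two_pow_mul_card_comm (k : ℕ) (w : Fin k → ι → Pauli) :
    4 ^ Fintype.card ι ≤ 2 ^ k * (Finset.univ.filter fun U : ι → Pauli => ∀ j, strSign (w j) U = 1).card := by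
  obtain ⟨m, hm, h1⟩ := sum_commProd_mul_strSign k w idStr
  have hcard : (2 : ℂ) ^ k * ((Finset.univ.filter fun U : ι → Pauli => ∀ j, strSign (w j) U = 1).card : ℂ) =
      ∑ U : ι → Pauli, commProd k w U * strSign idStr U := by
    rw [Finset.card_filter, Nat.cast_sum, Finset.mul_sum]
    refine Finset.sum_congr rfl fun U _ => ?_
    rw [strSign_idStr_left', mul_one, commProd_eq]
    split_ifs <;> simp
  have hnat : ((2 ^ k * (Finset.univ.filter fun U : ι → Pauli => ∀ j, strSign (w j) U = 1).card : ℕ) : ℂ) =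
      ((4 ^ Fintype.card ι * m : ℕ) : ℂ) := by
    push_cast; rw [hcard, hm]
  rw [Nat.cast_injective hnat]
  exact Nat.le_mul_of_pos_right _ (h1 rfl)

/-! ## 2. Fixed points of a word -/

omit [DecidableEq ι] in
/-- A label commuting with every letter of a word is FIXED by its walk. [cite: RudolphEtAl2025, §II B eq. (14)] -/
theorem walk_eq_self_of_comm : ∀ (k : ℕ) (w : Fin k → ι → Pauli) {U : ι → Pauli},
    (∀ j, strSign (w j) U = 1) → walk k w U = U := by
  intro k
  induction k with
  | zero => intro w U _; rfl
  | succ k ih =>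
    intro w U h
    rw [walk, ih (fun j => w (Fin.castSucc j)) fun j => h (Fin.castSucc j), cliffStep, if_pos (h (Fin.last k))]

/-- **EVERY WORD FIXES AT LEAST `4ⁿ/2ᵏ` LABELS** (identity included). [cite: RudolphEtAl2025, §II B eq. (14)]
[cite: AharonovEtAl2023, §2 (proof of Lemma 2)] -/
theorem fixed_ge (k : ℕ) (w : Fin k → ι → Pauli) :
    (4 : ℝ) ^ Fintype.card ι / 2 ^ k ≤ ∑ U : ι → Pauli, if walk k w U = U then (1 : ℝ) else 0 := by
  have hsub : (Finset.univ.filter fun U : ι → Pauli => ∀ j, strSign (w j) U = 1) ⊆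
      Finset.univ.filter fun U : ι → Pauli => walk k w U = U := by
    intro U hU
    simp only [Finset.mem_filter, Finset.mem_univ, true_and] at hU ⊢
    exact walk_eq_self_of_comm k w hU
  have hc := Finset.card_le_card hsub
  have h4 := pow_le_two_pow_mul_card_comm k w
  have hsum : (∑ U : ι → Pauli, if walk k w U = U then (1 : ℝ) else 0) =
      ((Finset.univ.filter fun U : ι → Pauli => walk k w U = U).card : ℝ) := by
    rw [Finset.card_filter]; push_cast; rfl
  rw [hsum]
  have h : ((4 ^ Fintype.card ι : ℕ) : ℝ) ≤
      ((2 ^ k * (Finset.univ.filter fun U : ι → Pauli => walk k w U = U).card : ℕ) : ℝ) := by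
    exact_mod_cast h4.trans (Nat.mul_le_mul_left _ hc)
  push_cast at h
  rw [div_le_iff₀ (by positivity)]
  linarith

/-! ## 3. The depth floor -/

/-- Splitting a sum over all labels into the identity term and the non-identity labels. [cite: KempeEtAl2010, §2
Observation 4] -/
private theorem sum_nonId' (f : (ι → Pauli) → ℝ) :
    ∑ V : {S : ι → Pauli // S ≠ idStr}, f V.1 = (∑ V, f V) - f idStr := by
  rw [← Finset.sum_erase_eq_sub (f := f) (Finset.mem_univ idStr)]
  exact (Finset.sum_subtype (Finset.univ.erase idStr) (fun V => by simp) f).symm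

/-- **TRACE FLOOR**: `Σ_{U ≠ I} #{g : walk (w g) U = U} ≥ |κ|·(4ⁿ/2ᵏ − 1)`. [cite: LevinPeres2017, §12.1]
[cite: RudolphEtAl2025, §II B eq. (14)] -/
theorem trace_ge (k : ℕ) (w : κ → Fin k → ι → Pauli) :
    (Fintype.card κ : ℝ) * ((4 : ℝ) ^ Fintype.card ι / 2 ^ k - 1) ≤
      ∑ V : {S : ι → Pauli // S ≠ idStr}, ∑ g : κ, if walk k (w g) V.1 = V.1 then (1 : ℝ) else 0 := by
  have hid : (∑ g : κ, if walk k (w g) idStr = idStr then (1 : ℝ) else 0) = Fintype.card κ := by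
    rw [Finset.sum_congr rfl fun g _ => if_pos (walk_eq_self_of_comm k (w g) fun j => ?_), Finset.sum_const,
      Finset.card_univ, nsmul_eq_mul, mul_one]
    unfold strSign; exact Finset.prod_eq_one fun i _ => by cases w g j i <;> rfl
  have hge : ∑ g : κ, (4 : ℝ) ^ Fintype.card ι / 2 ^ k ≤
      ∑ g : κ, ∑ U : ι → Pauli, if walk k (w g) U = U then (1 : ℝ) else 0 :=
    Finset.sum_le_sum fun g _ => fixed_ge k (w g)
  rw [Finset.sum_const, Finset.card_univ, nsmul_eq_mul] at hge
  rw [sum_nonId' fun U => ∑ g : κ, if walk k (w g) U = U then (1 : ℝ) else 0, hid, Finset.sum_comm]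
  linarith

/-- **DEPTH FLOOR `k ≥ 2n − 1` FOR EXACT CLIFFORD–PAULI MIXING BY ROTATION WORDS**: on `n` wires NO finite
family of length-`k` rotation words with `k + 2 ≤ 2n` — under ANY law uniform on its index set: i.i.d.,
position-dependent or position-correlated letters — is exactly Clifford–Pauli mixing.  HONEST SCOPE: exactness
only; attainment of depth `2n − 1` is not treated (module docstring). [cite: QuekEtAl2024, Methods §1.2 Definition 3]
[cite: ZhuEtAl2016, §1] [cite: LevinPeres2017, §12.1] -/
theorem not_isCliffordMixingLayer_words_of_depth_le {k : ℕ} (hk : k + 2 ≤ 2 * Fintype.card ι) [Nonempty κ]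
    (w : κ → Fin k → ι → Pauli) :
    ¬ IsCliffordMixingLayer (fun g => wordU k (w g)) (fun g => walk k (w g)) := by
  have hn : 1 ≤ Fintype.card ι := by omega
  haveI : Nonempty ι := Fintype.card_pos_iff.mp hn
  have hN : (0 : ℝ) < (4 : ℝ) ^ Fintype.card ι - 1 := by
    have : (4 : ℝ) ≤ (4 : ℝ) ^ Fintype.card ι := by
      simpa using pow_le_pow_right₀ (show (1 : ℝ) ≤ 4 by norm_num) hn
    linarith
  intro h
  have htr : ∑ V : {S : ι → Pauli // S ≠ idStr}, ∑ g : κ, (if walk k (w g) V.1 = V.1 then (1 : ℝ) else 0) =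
      Fintype.card κ := by
    have hV : ∀ V : {S : ι → Pauli // S ≠ idStr},
        (∑ g : κ, if walk k (w g) V.1 = V.1 then (1 : ℝ) else 0) =
          (Fintype.card κ : ℝ) / ((4 : ℝ) ^ Fintype.card ι - 1) := by
      intro V
      rw [← h.equi V.1 V.1 V.2 V.2, Finset.card_filter]; push_cast; rfl
    rw [Finset.sum_congr rfl fun V _ => hV V, Finset.sum_const, Finset.card_univ, nsmul_eq_mul, card_nonId,
      mul_div_assoc', mul_div_cancel_left₀ _ hN.ne']
  have hge := trace_ge k w
  rw [htr] at hge
  -- |κ| (4ⁿ/2ᵏ − 1) ≤ |κ| with |κ| ≥ 1 forces 4ⁿ ≤ 2 · 2ᵏ, against k + 2 ≤ 2n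
  have hk1 : (1 : ℝ) ≤ Fintype.card κ := by exact_mod_cast (Fintype.card_pos (α := κ))
  have hpow : (2 : ℝ) * 2 ^ k * 2 ≤ (4 : ℝ) ^ Fintype.card ι := by
    have h2 : (2 : ℝ) ^ (k + 2) ≤ (2 : ℝ) ^ (2 * Fintype.card ι) := pow_le_pow_right₀ (by norm_num) hk
    have h4 : (4 : ℝ) ^ Fintype.card ι = (2 : ℝ) ^ (2 * Fintype.card ι) := by
      rw [pow_mul]; norm_num
    rw [h4]; calc (2 : ℝ) * 2 ^ k * 2 = 2 ^ (k + 2) := by ring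
      _ ≤ _ := h2
  have h2k : (0 : ℝ) < 2 ^ k := by positivity
  have hq : (4 : ℝ) ≤ (4 : ℝ) ^ Fintype.card ι / 2 ^ k := by
    rw [le_div_iff₀ h2k]; linarith
  nlinarith

/-- **TWO LAYERS, TWO WIRES** (the smallest case): `k = 2`, `n = 2`, `2 + 2 ≤ 4`. [cite: QuekEtAl2024, Methods
§1.2 Definition 3] -/
theorem not_isCliffordMixingLayer_words_of_depth_le_two (h2 : Fintype.card ι = 2) [Nonempty κ] (w : κ → Fin 2 → ι → Pauli) :
    ¬ IsCliffordMixingLayer (fun g => wordU 2 (w g)) (fun g => walk 2 (w g)) :=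
  not_isCliffordMixingLayer_words_of_depth_le (by omega) w

end PauliMixingPurity.RotationWords.DepthFloor

end Literature.Computability.QuantumComplexity
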